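import Summits.PneNP.PneNP.Theses.PermanentDescent
import Literature.Computability.AlgebraicComplexity.PermanentBitsPPoly
import Literature.Computability.AlgebraicComplexity.ValiantHardnessJunctions
import Literature.Computability.QuantumComplexity.PermanentHardness
import Literature.Computability.Complexity.ReductionsProofs
import Literature.Computability.Complexity.PRelSigmaPi
import Literature.Computability.Complexity.PPolyTuringClosure
import Literature.Computability.Complexity.FoldBricks
import Literature.Computability.Complexity.CountingHierarchyPH
import Literature.Computability.Complexity.CountingProofs
import Literature.Computability.Complexity.TimeToSpace
import Literature.Computability.Complexity.Transducers
import HarnessLib.Audit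

/-!
# Disproof of `PermanentNotInP` — findings of the crux disprover (stmt-PneNP-16143, route `PermanentDescent`)

Crux: `Summit.PneNP.PneNP.Theses.PermanentDescent.PermanentNotInP` = `PermBits ∉ P`,
`PermBits = {⟨s, bin i⟩ : s ∈ {0,1}^{n·n}, bit i of perm_ℕ(M_s) = 1}` (row-major `M_s`).
Everything below is kernel-checked (`lean check` rc 0, 0 sorries); prose lives in docstrings.
Cycle 1 (refuter-cdisprove-stmt-PneNP-16143-0, 2026-08-17). VERDICT: NO KILL, and none is possible
short of `P = PP`: see §6.

* §0 `crux_iff`, `not_crux_iff` — the crux unfolds (`Iff.rfl`) to `PermBitsLang ∉ Classes.P`.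
* §1 parsing — `boolPair_mem_iff`, `boolPair_encodeNat_mem_iff`, `mem_iff_of_sq`, `not_mem_of_not_sq`:
  the pairing is injective and `encodeNat` canonical, so membership is the bare bit test; no
  encoding loophole (checked symbol by symbol: `boolPair`, `encodeNat`, `Matrix.permanent` over `ℕ`,
  `Classes.P` over Mathlib `FinTM2` — finite `σ`, `Λ`, input alphabet; standard `P`).
* §2 degenerate words — `nil_not_mem` (needed by line `Sketch` stub B), `not_mem_of_length_lt_two`,
  `emptyMatrix_mem` (`n = 0`: `perm ∅ = 1`, so `⟨ε, bin 0⟩ ∈ PermBits` — harmless), `emptyMatrix_not_mem_succ`.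
* §3 small models — `decide` evaluates the route's exact matrix expression: `perm J₂ = 2`, `perm I₂ = 1`,
  `perm [[1,1],[0,0]] = 0`; the language is the intended bit graph (agrees with rattack's Sanity.lean).
* §4 honesty of size — `permanent_cruxMatrix = permCount`, `≤ n!`, `not_mem_of_factorial_lt`,
  `not_mem_of_sq_lt`: bits `i > n²` are never set; hard instances have length `Θ(n²)`; no padding trick.
* §5 LOAD-BEARING PARAMETER "all bit positions" — `permanent_eq_det_of_neg_one_eq_one`,
  `slice_zero_iff_det`: the bit-0 fibre is `det_{𝔽₂}(M_s) = 1` (Gaussian elimination; in `P` in print),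
  and `perm mod 2^k ∈ FP` for each fixed `k` (Valiant 1979 §5): any proof must use unboundedly many bits.
  Other parameters (docstring-level, nothing to land): ring `ℕ` vs odd moduli (as hard: `Mod_pP`,
  Valiant 1979); uniform `P` vs `P/poly` (strengthening open, natural-proofs territory — census §Strengthen);
  all matrices vs structured families (planar/FKT slices easy, irrelevant to the language); exact vs
  approximate (JSV 2004 FPRAS: the top `O(log n)` bits are BPP-easy in the promise sense — the hardness
  sits in the MIDDLE bits, which is exactly the picked line's framing).
* §6 WHY IT RESISTS — `not_pneNP_of_not_crux : ¬ PermanentNotInP → ¬ PneNP` (via `PP_subset_P_of_mem_P`,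
  Valiant's theorem discharged in the tree): a counter-model is a polynomial-time `0/1` permanent,
  i.e. `P = PP = NP`. Re-derives rattack's SimpC.lean (evidence files are unreadable from seats' jails).
  Barriers for PROVERS (not refutations): relativization/bounded relativization (`P^A = PP^A`, `A = TQBF`),
  algebrization (AW09-type collapses include `PP`), natural proofs for every non-uniform form — as
  catalogued in `Literature/Barriers/PneNP/` and the census STRATEGY-CENSUS.md §0.
* §7 LINE `Sketch` (PICKED) — stubs A, B TRUE (B realisable because the tree's `FST` has a `keep/front`
  flush; needs `nil_not_mem`); stub C open, ≥ crux, implied by non-uniform `⊕ETH` (Curticapean–Xia 2015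
  Thm 1.3), witnesses need `k(c) ≥ c − O(1)` (Valiant 1979; Björklund–Husfeldt–Lyckberg 2017); checked
  degenerate rungs: `DTIME_pow_zero_eq_empty` (`c = 0` vacuous, `stubC_at_exponent_zero`),
  `permLowBits_zero` / `permLowBits_zero_mem_DTIME` (`k = 0` is `∅ ∈ DTIME(n^c)`, so `k(c) ≥ 1`).

Landed / landing: §1/§2/§4/§5 as `Theorems/PermanentNotInP/Negative/SliceStructure.lean` — ACCEPTED p161555
(commit cf623baf9cf4; namespace `Summit.PneNP.PneNP.Theorems.PermanentNotInP.Negative`, importable: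
`nil_not_mem_permBits`, `mem_permBits_iff_of_sq`, `not_mem_permBits_of_factorial_lt`, `mem_permBits_zero_iff_det`, …);
§6 as `Theorems/PermanentNotInP/Negative/CounterModelCollapse.lean` — ACCEPTED p161539 (commit 9dfbf5f3596d;
`PP_subset_P_of_not_permanentNotInP`, `NP_subset_P_of_not_permanentNotInP`, `not_pneNP_of_not_permanentNotInP`,
`testBit_per01PlainFn_iff_mem`, `preimage_pairFn_permBits`; axioms {propext, Classical.choice, Quot.sound}).
Seats may `import Summits.PneNP.PneNP.Theorems.PermanentNotInP.Negative.CounterModelCollapse` /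
`…Negative.SliceStructure` instead of this work file.
Near-misses / sorries: none. Next regimes for a re-arm: the lead's stuck stubs (none yet); a formal
`PermLowBits 1 ∈ P` would need a TM2 Gaussian elimination (L-sized in the brick algebra) — only worth it
if stub C's base case becomes load-bearing.
-/

set_option linter.dupNamespace false
set_option linter.unusedVariables false

noncomputable section

namespace Summit.PneNP.PneNP.Cruxes.PermanentNotInP.Disproof

open Literature.Computability.Complexity Literature.Computability.AlgebraicComplexity
open Summit.PneNP.PneNP.Theses.PermanentDescent _root_.Computability

/-! ## §0 The crux, unfolded -/

/-- The `0/1` matrix of the crux: row `a`, column `b` is the letter of `s` at position `b + n·a`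
(row-major), read as `0/1 ∈ ℕ`. [folklore] -/
def cruxMatrix (n : ℕ) (s : List Bool) : Matrix (Fin n) (Fin n) ℕ :=
  Matrix.of fun a b : Fin n => if s.getD ((b : ℕ) + n * (a : ℕ)) false then (1 : ℕ) else 0

/-- The crux language `PermBits` (the `let` of the route decl, verbatim up to `cruxMatrix`). [folklore] -/
def PermBitsLang : Language Bool :=
  {w | ∃ (n : ℕ) (s : List Bool) (i : ℕ), s.length = n * n ∧ w = boolPair s (encodeNat i) ∧
    Nat.testBit (Matrix.permanent (cruxMatrix n s)) i = true}

/-- The crux is literally `PermBitsLang ∉ P`. [folklore] -/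
theorem crux_iff : PermanentNotInP ↔ PermBitsLang ∉ Classes.P := Iff.rfl

/-- Its negation is literally `PermBitsLang ∈ P`. [folklore] -/
theorem not_crux_iff : ¬ PermanentNotInP ↔ PermBitsLang ∈ Classes.P := by
  rw [crux_iff, not_not]

/-! ## §1 Parsing the language (the pairing is injective, the index is canonical) -/

/-- Membership of a pair `⟨s, t⟩`: `t` must be a canonical numeral `encodeNat i`. [folklore] -/
theorem boolPair_mem_iff (s t : List Bool) :
    boolPair s t ∈ PermBitsLang ↔
      ∃ n i, s.length = n * n ∧ t = encodeNat i ∧ (cruxMatrix n s).permanent.testBit i = true := by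
  constructor
  · rintro ⟨n, s', i, hs', hw, hbit⟩
    have h := boolPair_injective (a₁ := (s, t)) (a₂ := (s', encodeNat i)) hw
    obtain ⟨rfl, rfl⟩ := Prod.mk.inj h
    exact ⟨n, i, hs', rfl, hbit⟩
  · rintro ⟨n, i, hs, rfl, hbit⟩
    exact ⟨n, s, i, hs, rfl, hbit⟩

/-- Membership of `⟨s, bin i⟩`. [folklore] -/
theorem boolPair_encodeNat_mem_iff (s : List Bool) (i : ℕ) :
    boolPair s (encodeNat i) ∈ PermBitsLang ↔
      ∃ n, s.length = n * n ∧ (cruxMatrix n s).permanent.testBit i = true := by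
  rw [boolPair_mem_iff]
  constructor
  · rintro ⟨n, j, hs, hij, hbit⟩
    have hji : i = j := by simpa [decode_encodeNat] using congrArg decodeNat hij
    subst hji
    exact ⟨n, hs, hbit⟩
  · rintro ⟨n, hs, hbit⟩
    exact ⟨n, i, hs, rfl, hbit⟩

/-- On a square payload the side `n` is determined. [folklore] -/
theorem mem_iff_of_sq {n : ℕ} {s : List Bool} (hs : s.length = n * n) (i : ℕ) :
    boolPair s (encodeNat i) ∈ PermBitsLang ↔ (cruxMatrix n s).permanent.testBit i = true := by
  rw [boolPair_encodeNat_mem_iff]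
  constructor
  · rintro ⟨m, hm, hbit⟩
    have hmn : m = n := Nat.mul_self_inj.mp (hm.symm.trans hs)
    subst hmn
    exact hbit
  · exact fun h => ⟨n, hs, h⟩

/-- Non-square payloads are never members. [folklore] -/
theorem not_mem_of_not_sq {s : List Bool} (hs : ∀ n, s.length ≠ n * n) (t : List Bool) :
    boolPair s t ∉ PermBitsLang := by
  rw [boolPair_mem_iff]
  rintro ⟨n, i, hn, -, -⟩
  exact hs n hn

/-! ## §2 Degenerate words -/

/-- The empty word is not a member (used by the guard transducer of line `Sketch`, stub B: its
`keep := false` branch outputs `ε`). [folklore] -/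
theorem nil_not_mem : ([] : List Bool) ∉ PermBitsLang := by
  rintro ⟨n, s, i, -, h, -⟩
  have := congrArg List.length h
  simp [length_boolPair] at this
  omega

/-- No word of length `< 2` is a member. [folklore] -/
theorem not_mem_of_length_lt_two {w : List Bool} (hw : w.length < 2) : w ∉ PermBitsLang := by
  rintro ⟨n, s, i, -, h, -⟩
  have := congrArg List.length h
  simp [length_boolPair] at this
  omega

/-- `n = 0`: the permanent of the empty matrix is `1`, so `⟨ε, bin 0⟩` IS a member … [folklore] -/
theorem emptyMatrix_mem : boolPair [] (encodeNat 0) ∈ PermBitsLang := by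
  rw [mem_iff_of_sq (n := 0) (by simp)]
  simp [Matrix.permanent_isEmpty]

/-- … and `⟨ε, bin (i+1)⟩` is not. [folklore] -/
theorem emptyMatrix_not_mem_succ (i : ℕ) : boolPair [] (encodeNat (i + 1)) ∉ PermBitsLang := by
  rw [mem_iff_of_sq (n := 0) (by simp)]
  simp [Matrix.permanent_isEmpty, Nat.testBit_succ]


/-! ## §3 Small models: the encoding computes the intended permanents (row-major) -/

/-- `perm J₂ = 2`: `⟨J₂, bin 1⟩ ∈ PermBits`, `⟨J₂, bin 0⟩ ∉ PermBits`. [folklore] -/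
theorem allOnes_two_mem : boolPair [true, true, true, true] (encodeNat 1) ∈ PermBitsLang ∧
    boolPair [true, true, true, true] (encodeNat 0) ∉ PermBitsLang := by
  rw [mem_iff_of_sq (n := 2) (by simp), mem_iff_of_sq (n := 2) (by simp)]
  decide

/-- `perm I₂ = 1`, `perm [[1,1],[0,1]] = 1`, `perm [[1,1],[0,0]] = 0` (row-major: the word
`[1,1,0,0]` is the matrix with FIRST ROW `11`). [folklore] -/
theorem two_by_two_values :
    (cruxMatrix 2 [true, false, false, true]).permanent = 1 ∧
    (cruxMatrix 2 [true, true, false, true]).permanent = 1 ∧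
    (cruxMatrix 2 [true, true, false, false]).permanent = 0 ∧
    (cruxMatrix 2 [true, true, true, true]).permanent = 2 := by
  decide

/-! ## §4 The instance size is honest: high bits vanish (`perm ≤ n!`) -/

/-- The crux matrix is the tree's `wordBits` array read as a `0/1` matrix
(`b + n·a = a·n + b`). [folklore] -/
theorem cruxMatrix_eq_of_wordBits (n : ℕ) (s : List Bool) :
    cruxMatrix n s = Matrix.of fun i j : Fin n => if wordBits s n (i, j) then (1 : ℕ) else 0 := by
  ext i j
  simp [cruxMatrix, wordBits, Nat.mul_comm, Nat.add_comm]

/-- Its permanent is the tree's permutation count `permCount` (so it agrees with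
`per01PlainFn` on square words, §6). [folklore] -/
theorem permanent_cruxMatrix (n : ℕ) (s : List Bool) :
    (cruxMatrix n s).permanent = permCount n (wordBits s n) := by
  rw [cruxMatrix_eq_of_wordBits]
  exact_mod_cast permanent_of_bool ℕ n (wordBits s n)

/-- `perm(M_s) ≤ n!`. [folklore] -/
theorem permanent_cruxMatrix_le_factorial (n : ℕ) (s : List Bool) :
    (cruxMatrix n s).permanent ≤ n.factorial := by
  rw [permanent_cruxMatrix]
  exact permCount_le_factorial n _

/-- Bits above `log₂ n!` are `0`: `⟨s, bin i⟩ ∉ PermBits` whenever `n! < 2^i` — in particular for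
`i > n²` (`factorial_lt_two_pow_mul_succ`); members have `|bin i| = O(n log n) = o(|s|)`, so there is
no padding loophole and the hard instances have length `Θ(n²)`. [folklore] -/
theorem not_mem_of_factorial_lt {n : ℕ} {s : List Bool} (hs : s.length = n * n) {i : ℕ}
    (hi : n.factorial < 2 ^ i) : boolPair s (encodeNat i) ∉ PermBitsLang := by
  rw [mem_iff_of_sq hs, Nat.testBit_eq_false_of_lt ((permanent_cruxMatrix_le_factorial n s).trans_lt hi)]
  exact Bool.false_ne_true

/-- Concretely: no member has bit index `i > n²`. [folklore] -/
theorem not_mem_of_sq_lt {n : ℕ} {s : List Bool} (hs : s.length = n * n) {i : ℕ} (hi : n * n < i) :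
    boolPair s (encodeNat i) ∉ PermBitsLang :=
  not_mem_of_factorial_lt hs ((factorial_lt_two_pow_mul_succ n).trans_le
    (Nat.pow_le_pow_right (by norm_num) hi))

/-! ## §5 Load-bearing parameter 1 — ALL bit positions: the bit-0 fibre is a GF(2) determinant

The crux quantifies over every bit `i` of `perm_ℕ`. Dropping that (fixing `i = 0`, or `i < k`) gives
a language in `P` IN PRINT: `perm ≡ det (mod 2)` (below, kernel-checked), and `perm mod 2^k` is
computable in `O(n^{4k-3})` arithmetic operations (Valiant 1979, Thm. 4 / §5) — so any proof of the
crux must use bit positions growing with `n`. The `∈ P` half needs a TM2 Gaussian elimination and is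
not formalised; the algebraic half is. -/

/-- Ring homomorphisms commute with the permanent. [folklore] -/
theorem map_permanent {R S : Type*} [CommSemiring R] [CommSemiring S] (f : R →+* S) {m : Type*}
    [Fintype m] [DecidableEq m] (M : Matrix m m R) : f M.permanent = (M.map f).permanent := by
  unfold Matrix.permanent
  simp [map_sum, map_prod]

/-- In a ring with `-1 = 1` (characteristic 2) the permanent IS the determinant. [folklore] -/
theorem permanent_eq_det_of_neg_one_eq_one {R : Type*} [CommRing R] (h : (-1 : R) = 1) {m : Type*}
    [Fintype m] [DecidableEq m] (M : Matrix m m R) : M.permanent = M.det := by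
  rw [Matrix.det_apply]
  unfold Matrix.permanent
  refine Finset.sum_congr rfl fun σ _ => ?_
  rcases Int.units_eq_one_or (Equiv.Perm.sign σ) with hσ | hσ
  · rw [hσ, one_smul]
  · rw [hσ, Units.neg_smul, one_smul, neg_eq_neg_one_mul, h, one_mul]

/-- `testBit m 0` is the parity of `m`. [folklore] -/
theorem testBit_zero_eq_true_iff (m : ℕ) : m.testBit 0 = true ↔ (m : ZMod 2) = 1 := by
  rw [Nat.testBit_zero, decide_eq_true_eq, show (1 : ZMod 2) = ((1 : ℕ) : ZMod 2) by simp,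
    ZMod.natCast_eq_natCast_iff', Nat.one_mod]

/-- **The bit-0 fibre of the crux language is nonsingularity over `𝔽₂`**:
`⟨s, bin 0⟩ ∈ PermBits ↔ det_{𝔽₂}(M_s) = 1`. Hence the slice `i = 0` (and, by Valiant 1979 Thm. 4,
every slice `i < k`) carries no hardness: a proof of the crux must use unboundedly many bit positions.
[folklore] -/
theorem slice_zero_iff_det {n : ℕ} {s : List Bool} (hs : s.length = n * n) :
    boolPair s (encodeNat 0) ∈ PermBitsLang ↔
      ((cruxMatrix n s).map (Nat.cast : ℕ → ZMod 2)).det = 1 := by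
  have hmap : (((cruxMatrix n s).permanent : ℕ) : ZMod 2) =
      ((cruxMatrix n s).map (Nat.cast : ℕ → ZMod 2)).permanent := by
    simpa only [Nat.coe_castRingHom] using map_permanent (Nat.castRingHom (ZMod 2)) (cruxMatrix n s)
  rw [mem_iff_of_sq hs, testBit_zero_eq_true_iff, hmap, permanent_eq_det_of_neg_one_eq_one (by decide)]

/-! ## §6 WHY IT RESISTS — a refutation of the crux decides the summit negatively

`¬ PermanentNotInP` is `PermBits ∈ P`; by an `FP` transcoder this puts the bit graph of the tree's
row-major `0/1` permanent `per01PlainFn` in `P`, hence `P^{per01PlainFn} ⊆ P`; Valiant's theorem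
(DISCHARGED in the tree: `ValiantFP.isSharpPHardFun_per01PlainFn`) gives `P^{#P} ⊆ P^{per01PlainFn}`,
and `NP ⊆ PP ⊆ P^{#P}`; so `NP ⊆ P`, i.e. `¬ PneNP`. This re-derives, importably, the evidence file
SimpC.lean of refuter-rattack-stmt-PneNP-16143-0 (2026-08-17), which seats cannot read from their jail.
Consequence for disprovers: there is no cheap kill — any counter-model is a polynomial-time algorithm
for the permanent, i.e. a proof of `P = PP (= NP)`. -/

/-- The transcoder `⟨x, u⟩ ↦ ⟨x, bin |u|⟩` from the tree's unary-indexed bit graph to `PermBits`. [folklore] -/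
def transFn : List Bool → List Bool := pairFn fstP (Brick.lenBinF ∘ sndP)

/-- `transFn ∈ FP`. [folklore] -/
theorem transFn_mem_FP : transFn ∈ FP :=
  pairFn_mem_FP fstP_mem_FP (comp_mem_FP Brick.lenBinF_mem_FP sndP_mem_FP)

/-- Value of `transFn`. [folklore] -/
theorem transFn_apply (z : List Bool) : transFn z = boolPair (fstP z) (encodeNat (sndP z).length) := by
  simp [transFn]

/-- The bits of `per01PlainFn` are exactly the memberships in `PermBits` (square case by
`permanent_cruxMatrix`, non-square case: both sides empty). [folklore] -/
theorem testBit_per01PlainFn_iff (x : List Bool) (i : ℕ) :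
    (per01PlainFn x).testBit i = true ↔ boolPair x (encodeNat i) ∈ PermBitsLang := by
  by_cases hsq : ∃ n, x.length = n * n
  · obtain ⟨n, hn⟩ := hsq
    rw [per01PlainFn_of_sq hn, mem_iff_of_sq hn, permanent_cruxMatrix]
  · rw [per01PlainFn_of_not_sq (fun h => hsq ⟨_, h.symm⟩), boolPair_encodeNat_mem_iff, Nat.zero_testBit]
    simp only [Bool.false_eq_true, false_iff, not_exists, not_and]
    exact fun n hn _ => hsq ⟨n, hn⟩

/-- `transFn ⁻¹' PermBits = bitLang per01PlainFn`. [folklore] -/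
theorem preimage_transFn : transFn ⁻¹' PermBitsLang = bitLang per01PlainFn := by
  ext z
  simp only [Set.mem_preimage, transFn_apply, bitLang, Set.mem_setOf_eq]
  exact (testBit_per01PlainFn_iff _ _).symm

/-- `PermBits ∈ P ⟹ bitLang per01PlainFn ∈ P` (`P` is closed under `FP` preimages). [folklore] -/
theorem bitLang_mem_P_of_mem_P (h : PermBitsLang ∈ Classes.P) : bitLang per01PlainFn ∈ Classes.P := by
  rw [← preimage_transFn]
  exact preimage_mem_P h transFn_mem_FP

/-- **`PermBits ∈ P ⟹ PP ⊆ P`** (Valiant 1979 + `PP ⊆ P^{#P}` + oracle plumbing, all in the tree).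
[cite: Valiant1979, Thm. 1] -/
theorem PP_subset_P_of_mem_P (h : PermBitsLang ∈ Classes.P) : PP ⊆ Classes.P := by
  have h1 : PRel (Oracle.ofLanguage (bitLang per01PlainFn)) ⊆ Classes.P := fun L hL =>
    PRelClass_P_subset_P (mem_PRelClass_iff.2 ⟨_, bitLang_mem_P_of_mem_P h, hL⟩)
  have h2 : PRel (Oracle.ofFun per01PlainFn) ⊆ PRel (Oracle.ofLanguage (bitLang per01PlainFn)) :=
    PRel_ofFun_subset_PRel_bitLang per01PlainFn (Polynomial.X + 1)
      (fun x => by simpa using per01PlainFn_lt_two_pow x)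
  have h3 : PSharpP ⊆ PRel (Oracle.ofFun per01PlainFn) :=
    Literature.Computability.QuantumComplexity.PSharpP_subset_PRel_ofFun_of_isSharpPHardFun
      ValiantFP.isSharpPHardFun_per01PlainFn
  exact fun L hL => h1 (h2 (h3 (PP_subset_PSharpP_holds hL)))

/-- `PermBits ∈ P ⟹ NP ⊆ P`. [cite: Valiant1979, Thm. 1] -/
theorem NP_subset_P_of_mem_P (h : PermBitsLang ∈ Classes.P) : Nondeterministic.NP ⊆ Classes.P :=
  fun L hL => PP_subset_P_of_mem_P h (NP_subset_PP_holds hL)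

/-- **A refutation of the crux refutes the summit**: `¬ PermanentNotInP → ¬ PneNP`
(equivalently `PneNP → PermanentNotInP`: the crux is implied by the summit). Kernel-checked,
sorry-free. [cite: Valiant1979, Thm. 1] -/
theorem not_pneNP_of_not_crux (h : ¬ PermanentNotInP) : ¬ _root_.PneNP := by
  have hP : PermBitsLang ∈ Classes.P := not_crux_iff.mp h
  have hPeq : PNPWave0.P Bool = Classes.P := P_bool_eq_holds
  have hNeq : PNPWave0.NP Bool = Nondeterministic.NP := np_bool_eq
  rintro ⟨L, hL, hL'⟩
  rw [hNeq] at hL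
  rw [hPeq] at hL'
  exact hL' (NP_subset_P_of_mem_P hP hL)

/-- Hence, in the tree, `¬ crux ↔ (PermBits ∈ P)` and `¬ crux → PP ⊆ P`; with the converse
`PP ⊆ P → PermBits ∈ P` (PermBits ∈ P^{#P}, not formalised here) the crux is EQUIVALENT to `P ≠ PP`.
[folklore] -/
theorem PP_subset_P_of_not_crux (h : ¬ PermanentNotInP) : PP ⊆ Classes.P :=
  PP_subset_P_of_mem_P (not_crux_iff.mp h)


/-! ## §7 Line `Sketch` (xp-ladder-middle-bits; PICKED.md 2026-08-17) — targets

The lead's skeleton `Cruxes/PermanentNotInP/Lines/Sketch.lean` has three stubs: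

* A `stub_preimageFST` (pull `DTIME(n^c)` back along a length-non-increasing FST into
  `DTIME(n^(c+1))`): TRUE plumbing (run the transducer, `FST.timeComputable_eval`, then the decider).
  At `c = 0` its hypothesis is unsatisfiable (`DTIME_pow_zero_eq_empty` below), so nothing to check
  there; for `c ≥ 1` even `DTIME(n^c)` (same exponent) would do. Not attackable.
* B `stub_guardFST` (a length-non-increasing FST `T_k` with `T_k w ∈ PermBits ↔ w ∈ PermLowBits k`):
  TRUE in the tree's FST model, which has a final `keep`/`front` flush — copy the input, and set
  `keep := false` (output `ε`) unless the post-separator part read so far is `encodeNat i` with `i < k`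
  (a finite set of words, finite state); correctness needs exactly `nil_not_mem` (§2) and the parse
  lemma `boolPair_encodeNat_mem_iff` (§1). (Even a flush-free Mealy machine works: copy verbatim and,
  at the first letter where the post-separator prefix leaves the prefix-closure of
  `{encodeNat i : i < k}`, emit one `false` and go silent — a nonempty numeral ending in `0` is never
  an `encodeNat`.) Not attackable.
* C `stub_unboundedPrecisionExponent` (`∀ c, ∃ k, PermLowBits k ∉ DTIME(n^c)`): the OPEN core, an
  honest STRENGTHENING of the crux (C ⟹ crux by A+B; crux ⟹ C is not known). Calibration from print:
  the rung `PermLowBits k` is decidable with `O(n^{4k-3})` arithmetic operations (Valiant 1979 §5) and in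
  time `n^{k+O(1)}` (Björklund–Husfeldt–Lyckberg, IPL 125 (2017) 20–25), so on inputs of length
  `N ≈ 2n²` any witness must have `k ≥ c - O(1)` (up to the RAM→TM2 overhead): precision has to grow
  linearly with the target exponent. Conversely `¬C` (one exponent `c` for every precision `k`,
  constants depending on `k`, machines non-uniform in `k`) would be a non-uniform fixed-parameter
  algorithm for `perm mod 2^k`, against Curticapean–Xia (FOCS 2015, arXiv:1511.02321, Thm. 1.3, p. 5:
  `perm mod 2^k` is `⊕W[1]`-hard in `k`, and has no `n^{o(k / log k)}` algorithm under `⊕ETH`) — so C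
  is implied by (non-uniform) `⊕ETH` and is not refutable by lookup; I found no unconditional handle.
  Degenerate rungs (checked below): `c = 0` is vacuous (`DTIME(n^0) = ∅`), and the rung `k = 0` is the
  EMPTY language, which is in `DTIME(n)`, so every witness for `c ≥ 1` has `k ≥ 1`; `k = 1` is the
  `𝔽₂`-determinant fibre of §5.
-/

/-- The rung `PermLowBits k` of line `Sketch` (its set-builder, verbatim up to `cruxMatrix`). [folklore] -/
def PermLowBitsLang (k : ℕ) : Language Bool :=
  {w | ∃ (n : ℕ) (s : List Bool) (i : ℕ), i < k ∧ s.length = n * n ∧ w = boolPair s (encodeNat i) ∧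
    Nat.testBit (Matrix.permanent (cruxMatrix n s)) i = true}

/-- The rungs exhaust the crux language. [folklore] -/
theorem mem_permLowBits_iff (k : ℕ) (w : List Bool) :
    w ∈ PermLowBitsLang k ↔ ∃ s i, i < k ∧ w = boolPair s (encodeNat i) ∧ w ∈ PermBitsLang := by
  constructor
  · rintro ⟨n, s, i, hik, hs, rfl, hbit⟩
    exact ⟨s, i, hik, rfl, n, s, i, hs, rfl, hbit⟩
  · rintro ⟨s, i, hik, rfl, hmem⟩
    obtain ⟨n, hs, hbit⟩ := (boolPair_encodeNat_mem_iff s i).1 hmem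
    exact ⟨n, s, i, hik, hs, rfl, hbit⟩

/-- **The rung `k = 0` is the empty language.** [folklore] -/
theorem permLowBits_zero : PermLowBitsLang 0 = ((∅ : Set (List Bool)) : Language Bool) := by
  ext w
  simp [PermLowBitsLang]

/-- The halting convention empties the input stack and `m` steps pop at most `P · m` symbols, so a
decider that halts within `T w` steps on `w` forces `|w| ≤ 1 + P · T w`. [folklore] -/
theorem length_le_of_decidesInTime {L : Language Bool} {T : List Bool → ℕ}
    {M : Turing.TM2ComputableAux Bool Bool} (h : DecidesInTime id L T M) (w : List Bool) :
    w.length ≤ 1 + TimeToSpace.machinePopBound M.tm * T w := by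
  obtain ⟨n, hn, hrun⟩ := TM2Iter.reachesIn_of_outputsWithin M (h w)
  have h1 := TimeToSpace.stkLen_le_of_iterate M.tm hrun
  rw [SpaceLoop.stkLen_initList, TimeToSpace.stkLen_haltList, List.length_map, List.length_map] at h1
  have h2 : (encodeBool (L.boolIndicator w)).length = 1 := rfl
  have h3 : TimeToSpace.machinePopBound M.tm * n ≤ TimeToSpace.machinePopBound M.tm * T w :=
    Nat.mul_le_mul_left _ hn
  simp only [id] at h1
  omega

/-- **Constant time classes are empty** in this model (so are all sublinear ones). [folklore] -/
theorem timeClass_const_eq_empty (C : ℕ) : TimeClass (fun _ => C) = ∅ := by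
  ext L
  simp only [Set.mem_empty_iff_false, iff_false]
  rintro ⟨M, hM⟩
  have h := length_le_of_decidesInTime hM
    (List.replicate (1 + TimeToSpace.machinePopBound M.tm * C + 1) false)
  simp only [List.length_replicate] at h
  omega

/-- **`DTIME(n^0) = ∅`**: the exponent-`0` rung of every `DTIME(n^c)` ladder is vacuous. [folklore] -/
theorem DTIME_pow_zero_eq_empty : DTIME (fun n => n ^ 0) = ∅ := by
  ext L
  simp only [DTIME, pow_zero, mul_one, Set.mem_setOf_eq, Set.mem_empty_iff_false, iff_false]
  rintro ⟨c, hc⟩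
  rw [timeClass_const_eq_empty] at hc
  exact hc

/-- Stub C of line `Sketch` at `c = 0` holds for EVERY `k` (even the empty rung `k = 0`):
no information lives at exponent `0`. [folklore] -/
theorem stubC_at_exponent_zero (k : ℕ) : PermLowBitsLang k ∉ DTIME (fun n => n ^ 0) := by
  rw [DTIME_pow_zero_eq_empty]
  exact id

/-- The empty language is decidable in linear time (a one-state transducer that discards its input
and answers `0`; `FST.timeComputable_eval`). [folklore] -/
theorem empty_mem_DTIME_linear : ((∅ : Set (List Bool)) : Language Bool) ∈ DTIME (fun n => n) := by
  let T : FST Unit Bool Bool := ⟨(), fun _ _ => ((), []), fun _ => [false], fun _ => false⟩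
  have hev : ∀ w : List Bool, T.eval w = [false] := fun w => by simp [FST.eval, T]
  obtain ⟨M, hM⟩ := T.timeComputable_eval
  refine ⟨T.maxEmit + 3, M, fun w => ?_⟩
  have hind : ((∅ : Set (List Bool)) : Language Bool).boolIndicator w = false :=
    (Set.notMem_iff_boolIndicator _ _).1 (Set.notMem_empty w)
  have hout : encodeBool (((∅ : Set (List Bool)) : Language Bool).boolIndicator w) = T.eval w := by
    rw [hev, hind]; rfl
  show M.OutputsWithin (id w) _ _
  rw [hout]
  exact (hM w).mono (by simp only [id]; nlinarith [Nat.zero_le (T.maxEmit * w.length)])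

/-- **The rung `k = 0` never witnesses stub C at a contentful exponent**: `PermLowBits 0 = ∅ ∈ DTIME(n^c)`
for every `c ≥ 1`. So a proof of stub C must produce `k(c) ≥ 1` — and by the printed upper bounds
(Valiant 1979 §5; Björklund–Husfeldt–Lyckberg 2017) in fact `k(c) ≥ c - O(1)`. [folklore] -/
theorem permLowBits_zero_mem_DTIME {c : ℕ} (hc : 1 ≤ c) : PermLowBitsLang 0 ∈ DTIME (fun n => n ^ c) := by
  rw [permLowBits_zero]
  refine DTIME_mono (fun n => ?_) empty_mem_DTIME_linear
  calc n = n ^ 1 := (pow_one n).symm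
    _ ≤ n ^ c := by
        rcases Nat.eq_zero_or_pos n with rfl | hn
        · simp
        · exact Nat.pow_le_pow_right hn hc

end Summit.PneNP.PneNP.Cruxes.PermanentNotInP.Disproof

end
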